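import Summits.QuantumFields.YangMills.Theorems.UnitScaleTiltProp7CentreHarmonicDivEngineInhom
import Summits.QuantumFields.YangMills.Theorems.UnitScaleTiltProp7CovHodgeSplit
import Summits.QuantumFields.YangMills.Theorems.UnitScaleTiltProp7TrueLinIterStructure
import HarnessLib

/-!
# Route `UnitScaleTilt`, crux K1 «MinimiserStabilityRegPr» (stmt-QuantumFields-19200), route-R E′ S3 K-form engine (DESIGN-S3-KFORM-ENGINE-g15) — ROW R3′, DOOR-FIRST:
# THE COVARIANT REAL CORE — coarse covariant differences of the potential's centre values are booked by the coarse-gauge function `Λ`, the fibre defect `q`, the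
# reduced-vs-line defect, the line-vs-face step, and ONE displayed Gauss row (the face-flux pairing `2|Σ_c Re tr(D_cᴴ·FACE_c)|` in the currencies (Kg′)+(eM)+(free-θ·M)+J_VH)

Cell `ym3-torus`, width seat `ym3-torus-px17` (gen 2; ★ym-ust-19200-p1 g15 NAMER round 4 «R3′ proper … is your next SIGNATURE, option of your choice, the located risk explicit»;
LOCATE-R3PRIME-COVFACEFLUX-px17g2.md §0.1 (P), §0.6 option Ⅱ).  THEOREMS ONLY (0 `def`, 0 `sorry`); `--supports stmt-QuantumFields-19200`, count-neutral.  YM₃ on T³ is a ladder rung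
(R3), not the Clay problem; nothing here claims a stub, the crux, d = 4 or the mass gap; R3′'s analytic rows are DISPLAYED, not proved, in this file.

WHY.  The flat real core ✓ `Prop7CentreHarmonicDivEngine.sum_coarseDiff_sq_le` reads the constraint `ℓ·Q_kB + δλ = r`, splits the line mean `ℓQ_kB = ℓE + W` (face part `W`), and uses the
EXACT orthogonality `Σ_c δλ(c)·W(c) = 0` (Gauss).  At a curved background (R3′ of the K-form engine) the same algebra runs with: R2′ ✓ `Prop7CovHodgeConstraint.covConstraint_on_hodge_parts_covD`
∕ ✓p666871 (`G_k(B)(c) + P_V(Λ − φ∘embIter k)(c) = q(c)`, `P_Vξ(c) = ξ(c₋) − V(c)ξ(c₊)V(c)*`), the reduced-vs-line defect (L) ✓p608741 ∘ ✓ `sum_normSq_lineIter_sub_engine_le_of_tower`, the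
line-vs-face step (E) ✓p669005 `Prop7CovLineFaceTrace.normSq_blockLineMean_sub_faceMean_le` (junk-free), and the covariant Gauss law ✓p669014 `Prop7CovCombGauss.sum_R_divB_eq` whose interior
holonomy defect and near-face junction make the pairing `X := Σ_c Re tr(D_cᴴ·FACE_c)` NON-zero.  THIS FILE is the door: the four inputs are DISPLAYED as hypotheses in their suppliers'
currencies (`hR2` identity; `hL`, `hE` operator-norm `ℓ²` rows; `hX` the Gauss row with its junk written in the currencies of the LOCATE's option Ⅱ — centre-based commutator energy `K′`
(coefficient `(C_F∕θ)·ℓ`), free-`θ` mass `θ·ℓ⁻¹·M`, `e`-mass `C_e·e·ℓ⁻¹·M`, the (E)-energy `C_G·Elong`, and the coarse-transport junction `J_VH`), and the conclusion is the Hilbert–Schmidt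
`ℓ²`-mass of the coarse covariant differences `D_c = φ(c_{c₋}) − V(c)φ(c_{c₊})V(c)*` (`c_y = embIter k y`) — exactly the letter R4 ✓p666125∕R5 consume.  The proof is the HS binomial
(✓ `Prop7CovHodgeSplit.sum_normSq_add_eq`): `|D|² = ⟨D, FACE⟩ + ⟨D, Rest⟩ ≤ ⟨D,FACE⟩ + ½|D|² + ½|Rest|²`, `Rest = (LINE − FACE) + (G − LINE) + P_VΛ − q`.

WHAT IS PROVED (ns `…Theorems.Prop7CovFaceFluxRow`; any `P`, level `k`, `SU(N)`): `sum_normSq_four_le` (HS of a four-term sum), `sum_normSq_neg`, `sum_normSq_eq_re_trace`,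
`sum_normSq_pureGauge_le` (`Σ_c|P_VΛ(c)|²_HS ≤ 4dN·Σ_y‖Λ y‖²`), ★★★ `sum_normSq_centreDiff_le_of_rows` — THE R3′ DOOR:
`Σ_c |D_c|²_HS ≤ J + 4N·(Elong + Def + Σ_c‖q c‖²) + 16dN·Σ_y‖Λ y‖²` with `J := (C_F∕θ)·ℓ·K′ + θ·ℓ⁻¹·M + C_e·e·ℓ⁻¹·M + C_G·Elong + J_VH` displayed in `hX`.
HONEST SCOPE.  Algebra over displayed rows; the INHABITANTS of `hX` (Gauss-defect bookkeeping with h-averaged comb multiplicities `m̄_p ≤ 3ℓ`, LOCATE §0.2∕§4; the junction `J_VH`, LOCATE §0.4) and of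
`hE` at the block (T-F + torus re-indexing) are separate files; `K′`, `M`, `J_VH` are free reals here (their letters are fixed where they are bounded).

References: T. Bałaban, CMP 95 (1984) 17–40 [Balaban1984PropagatorsI] ((1.18)–(1.21) pp.20–21, Prop. 1.1 (1.90) p.33); CMP 99 (1985) 389–434 [Balaban1985BackgroundPropagators] ((3.8) p.392,
(3.117)–(3.122) pp.419–420, Thm 3.11 p.416); CMP 98 (1985) 17–51 [Balaban1985Averaging] ((11) p.19); CMP 102 (1985) 277–309 [Balaban1985Variational] (Prop. 7 p.299, (141)–(143) p.299).
-/

set_option autoImplicit false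

noncomputable section

open scoped BigOperators Matrix.Norms.L2Operator Matrix

namespace Summit.QuantumFields.YangMills.Theorems.Prop7CovFaceFluxRow

open Literature.MathematicalPhysics.QuantumFieldTheory.Balaban1983to89
open Finset
open B15DeterminingSets (embIter)
open Summit.QuantumFields.YangMills.Theorems.Prop7CovariantCoercivity (re_trace_conjTranspose_mul_self re_trace_conjTranspose_mul_comm)
open Summit.QuantumFields.YangMills.Theorems.Prop7CovHodgeSplit (sum_normSq_add_eq)
open Summit.QuantumFields.YangMills.Theorems.Prop7CentreHarmonicDivEngineInhom (sum_normSq_add_le)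
open Summit.QuantumFields.YangMills.Theorems.Prop7PinnedFlatCoercivity (sum_normSq_le_mul_opNorm_sq sum_pbond_tgt_add_src)
open Summit.QuantumFields.YangMills.Theorems.Prop7TrueLinIterStructure (norm_pureGauge_le)

variable {P : Params} {k : ℕ} {N : ℕ}

/-! ## §1 Hilbert–Schmidt bookkeeping -/

/-- HS of a four-term sum: `|a + b + c + e|² ≤ 4(|a|² + |b|² + |c|² + |e|²)`. [folklore] -/
theorem sum_normSq_four_le (A B C E : Matrix (Fin N) (Fin N) ℂ) :
    ∑ a : Fin N, ∑ b : Fin N, Complex.normSq ((A + B + C + E) a b)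
      ≤ 4 * (∑ a : Fin N, ∑ b : Fin N, Complex.normSq (A a b) + ∑ a : Fin N, ∑ b : Fin N, Complex.normSq (B a b)
          + ∑ a : Fin N, ∑ b : Fin N, Complex.normSq (C a b) + ∑ a : Fin N, ∑ b : Fin N, Complex.normSq (E a b)) := by
  have h1 := sum_normSq_add_le (A + B) (C + E)
  have h2 := sum_normSq_add_le A B
  have h3 := sum_normSq_add_le C E
  rw [show A + B + C + E = (A + B) + (C + E) by abel]
  linarith

/-- `|−M|²_HS = |M|²_HS`. [folklore] -/
theorem sum_normSq_neg (M : Matrix (Fin N) (Fin N) ℂ) :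
    ∑ a : Fin N, ∑ b : Fin N, Complex.normSq ((-M) a b) = ∑ a : Fin N, ∑ b : Fin N, Complex.normSq (M a b) := by
  simp [Matrix.neg_apply]

/-- `|M|²_HS = Re tr(MᴴM)` in the `normSq` reading. [folklore] -/
theorem sum_normSq_eq_re_trace (M : Matrix (Fin N) (Fin N) ℂ) :
    ∑ a : Fin N, ∑ b : Fin N, Complex.normSq (M a b) = ((Mᴴ * M).trace).re := by
  rw [re_trace_conjTranspose_mul_self]
  exact Finset.sum_congr rfl fun a _ => Finset.sum_congr rfl fun b _ => (Complex.sq_norm _).symm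

variable [NeZero N]

/-- The coarse covariant pure gauge of `Λ` in HS: `Σ_c |Λ(c₋) − V(c)Λ(c₊)V(c)*|²_HS ≤ 4dN·Σ_y ‖Λ y‖²` (op-norm on the right). [cite: Balaban1985Averaging, (11) p.19] -/
theorem sum_normSq_pureGauge_le (V : GaugeField P k (Matrix.specialUnitaryGroup (Fin N) ℂ)) (Λ : Site P k → Matrix (Fin N) (Fin N) ℂ) :
    ∑ c : PBond P k, ∑ a : Fin N, ∑ b : Fin N, Complex.normSq
        ((Λ c.src - ((V c : Matrix.specialUnitaryGroup (Fin N) ℂ) : Matrix (Fin N) (Fin N) ℂ) * Λ c.tgt * star ((V c : Matrix.specialUnitaryGroup (Fin N) ℂ) : Matrix (Fin N) (Fin N) ℂ)) a b)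
      ≤ 4 * P.d * N * ∑ y : Site P k, ‖Λ y‖ ^ 2 := by
  have hpt : ∀ c : PBond P k, ∑ a : Fin N, ∑ b : Fin N, Complex.normSq
        ((Λ c.src - ((V c : Matrix.specialUnitaryGroup (Fin N) ℂ) : Matrix (Fin N) (Fin N) ℂ) * Λ c.tgt * star ((V c : Matrix.specialUnitaryGroup (Fin N) ℂ) : Matrix (Fin N) (Fin N) ℂ)) a b)
      ≤ N * (2 * (‖Λ c.tgt‖ ^ 2 + ‖Λ c.src‖ ^ 2)) := by
    intro c
    refine (sum_normSq_le_mul_opNorm_sq _).trans (mul_le_mul_of_nonneg_left ?_ (Nat.cast_nonneg N))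
    have h := norm_pureGauge_le V Λ c
    have h0 : 0 ≤ ‖Λ c.src - ((V c : Matrix.specialUnitaryGroup (Fin N) ℂ) : Matrix (Fin N) (Fin N) ℂ) * Λ c.tgt
        * star ((V c : Matrix.specialUnitaryGroup (Fin N) ℂ) : Matrix (Fin N) (Fin N) ℂ)‖ := norm_nonneg _
    nlinarith [h, h0, sq_nonneg (‖Λ c.src‖ - ‖Λ c.tgt‖), norm_nonneg (Λ c.src), norm_nonneg (Λ c.tgt)]
  calc _ ≤ ∑ c : PBond P k, (N : ℝ) * (2 * (‖Λ c.tgt‖ ^ 2 + ‖Λ c.src‖ ^ 2)) := Finset.sum_le_sum fun c _ => hpt c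
    _ = N * (2 * ∑ c : PBond P k, (‖Λ c.tgt‖ ^ 2 + ‖Λ c.src‖ ^ 2)) := by rw [← Finset.mul_sum, ← Finset.mul_sum]
    _ = 4 * P.d * N * ∑ y : Site P k, ‖Λ y‖ ^ 2 := by rw [sum_pbond_tgt_add_src (fun y => ‖Λ y‖ ^ 2)]; ring

/-! ## §2 The R3′ door -/

/-- ★★★ **THE R3′ DOOR — the covariant real core with its four rows displayed.**  At level `k`, for an `SU(N)` coarse transport letter `V` (R2′'s `Ū₀^{(k)}`, = the datum on the fibre),
a fine site field `φ` (the potential `φ₀`), the coarse gauge function `Λ`, the fibre defect `q`, the reduced family `G` and ANY bond fields `LINE`, `FACE` (the covariant straight-line block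
functional and its per-line face part, ✓p669005's letters at the consumer), with
(hR2) `G c + P_V(Λ − φ∘embIter k)(c) = q c` (✓p666871), (hL) `Σ_c‖G c − LINE c‖² ≤ Def` (✓p608741∘lineIter_sub_engine), (hE) `Σ_c‖LINE c − FACE c‖² ≤ Elong` (✓p669005 + re-indexing: `Elong = ℓ·G_long,W(B)`),
(hX) the GAUSS ROW `2·|Σ_c Re tr(D_cᴴ·FACE_c)| ≤ (C_F∕θ)·ℓ·K′ + θ·ℓ⁻¹·M + C_e·e·ℓ⁻¹·M + C_G·Elong + J_VH` (LOCATE-R3PRIME §0.2∕§4: h-averaged comb multiplicities; `K′` the centre-based commutator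
energy (Kg′), `J_VH` the coarse-transport junction — displayed, inhabited in those files),
THEN `Σ_c |φ(c_{c₋}) − V(c)φ(c_{c₊})V(c)*|²_HS ≤ [(C_F∕θ)ℓK′ + θℓ⁻¹M + C_e e ℓ⁻¹M + C_G Elong + J_VH] + 4N(Elong + Def + Σ_c‖q c‖²) + 16dN·Σ_y‖Λ y‖²`.
[cite: Balaban1984PropagatorsI, Prop. 1.1 (1.90) p.33, (1.21) p.21; Balaban1985BackgroundPropagators, (3.8) p.392, Thm 3.11 p.416; Balaban1985Variational, Prop. 7 p.299, (141)-(143) p.299] -/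
theorem sum_normSq_centreDiff_le_of_rows (V : GaugeField P k (Matrix.specialUnitaryGroup (Fin N) ℂ))
    (φ : Site P 0 → Matrix (Fin N) (Fin N) ℂ) (Λ : Site P k → Matrix (Fin N) (Fin N) ℂ) (G q LINE FACE : PBond P k → Matrix (Fin N) (Fin N) ℂ)
    {Def Elong CF θ ℓ K' M Ce e CG JVH : ℝ}
    (hR2 : ∀ c : PBond P k, G c + ((Λ c.src - φ (embIter k c.src))
        - ((V c : Matrix.specialUnitaryGroup (Fin N) ℂ) : Matrix (Fin N) (Fin N) ℂ) * (Λ c.tgt - φ (embIter k c.tgt)) * star ((V c : Matrix.specialUnitaryGroup (Fin N) ℂ) : Matrix (Fin N) (Fin N) ℂ))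
        = q c)
    (hL : ∑ c : PBond P k, ‖G c - LINE c‖ ^ 2 ≤ Def)
    (hE : ∑ c : PBond P k, ‖LINE c - FACE c‖ ^ 2 ≤ Elong)
    (hX : 2 * |∑ c : PBond P k, (((φ (embIter k c.src)
          - ((V c : Matrix.specialUnitaryGroup (Fin N) ℂ) : Matrix (Fin N) (Fin N) ℂ) * φ (embIter k c.tgt) * star ((V c : Matrix.specialUnitaryGroup (Fin N) ℂ) : Matrix (Fin N) (Fin N) ℂ))ᴴ
          * FACE c).trace).re|
        ≤ CF / θ * ℓ * K' + θ * ℓ⁻¹ * M + Ce * e * ℓ⁻¹ * M + CG * Elong + JVH) :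
    ∑ c : PBond P k, ∑ a : Fin N, ∑ b : Fin N, Complex.normSq ((φ (embIter k c.src)
        - ((V c : Matrix.specialUnitaryGroup (Fin N) ℂ) : Matrix (Fin N) (Fin N) ℂ) * φ (embIter k c.tgt) * star ((V c : Matrix.specialUnitaryGroup (Fin N) ℂ) : Matrix (Fin N) (Fin N) ℂ)) a b)
      ≤ (CF / θ * ℓ * K' + θ * ℓ⁻¹ * M + Ce * e * ℓ⁻¹ * M + CG * Elong + JVH)
        + 4 * N * (Elong + Def + ∑ c : PBond P k, ‖q c‖ ^ 2) + 16 * P.d * N * ∑ y : Site P k, ‖Λ y‖ ^ 2 := by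
  -- letters
  set D : PBond P k → Matrix (Fin N) (Fin N) ℂ := fun c => φ (embIter k c.src)
      - ((V c : Matrix.specialUnitaryGroup (Fin N) ℂ) : Matrix (Fin N) (Fin N) ℂ) * φ (embIter k c.tgt) * star ((V c : Matrix.specialUnitaryGroup (Fin N) ℂ) : Matrix (Fin N) (Fin N) ℂ) with hD
  set PL : PBond P k → Matrix (Fin N) (Fin N) ℂ := fun c => Λ c.src
      - ((V c : Matrix.specialUnitaryGroup (Fin N) ℂ) : Matrix (Fin N) (Fin N) ℂ) * Λ c.tgt * star ((V c : Matrix.specialUnitaryGroup (Fin N) ℂ) : Matrix (Fin N) (Fin N) ℂ) with hPL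
  set Rest : PBond P k → Matrix (Fin N) (Fin N) ℂ := fun c => (LINE c - FACE c) + (G c - LINE c) + PL c + (-q c) with hRest
  have S : ∀ X : Matrix (Fin N) (Fin N) ℂ, 0 ≤ ∑ a : Fin N, ∑ b : Fin N, Complex.normSq (X a b) :=
    fun X => Finset.sum_nonneg fun _ _ => Finset.sum_nonneg fun _ _ => Complex.normSq_nonneg _
  -- the R2′ identity rearranged: `D = FACE + Rest`
  have hsplit : ∀ c : PBond P k, D c = FACE c + Rest c := by
    intro c
    have h := hR2 c
    have hD' : D c = G c + PL c - q c := by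
      rw [hD, hPL]
      simp only
      rw [← h]
      noncomm_ring
    rw [hD']
    show G c + PL c - q c = FACE c + ((LINE c - FACE c) + (G c - LINE c) + PL c + (-q c))
    abel
  -- HS binomial per bond: `|D|² ≤ 2 Re tr(Dᴴ FACE) + |Rest|²`
  have hpt : ∀ c : PBond P k, ∑ a : Fin N, ∑ b : Fin N, Complex.normSq (D c a b)
      ≤ 2 * (((D c)ᴴ * FACE c).trace).re + ∑ a : Fin N, ∑ b : Fin N, Complex.normSq (Rest c a b) := by
    intro c
    have hF : FACE c = D c + (-Rest c) := by rw [hsplit c]; abel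
    have hbin := sum_normSq_add_eq (D c) (-Rest c)
    rw [← hF] at hbin
    have hcross : (((-Rest c)ᴴ * D c).trace).re = -(((D c)ᴴ * Rest c).trace).re := by
      rw [Matrix.conjTranspose_neg, Matrix.neg_mul, Matrix.trace_neg, Complex.neg_re, re_trace_conjTranspose_mul_comm]
    have hDF : (((D c)ᴴ * FACE c).trace).re = ∑ a : Fin N, ∑ b : Fin N, Complex.normSq (D c a b) - (((D c)ᴴ * Rest c).trace).re := by
      have e1 : FACE c = D c - Rest c := by rw [hsplit c]; abel
      rw [e1, Matrix.mul_sub, Matrix.trace_sub, Complex.sub_re, ← sum_normSq_eq_re_trace]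
    rw [sum_normSq_neg] at hbin
    nlinarith [hbin, hcross, hDF, S (FACE c), S (Rest c), S (D c)]
  -- sum over bonds
  have hsum : ∑ c : PBond P k, ∑ a : Fin N, ∑ b : Fin N, Complex.normSq (D c a b)
      ≤ 2 * ∑ c : PBond P k, (((D c)ᴴ * FACE c).trace).re + ∑ c : PBond P k, ∑ a : Fin N, ∑ b : Fin N, Complex.normSq (Rest c a b) := by
    rw [Finset.mul_sum, ← Finset.sum_add_distrib]
    exact Finset.sum_le_sum fun c _ => hpt c
  -- the rest in the suppliers' currencies
  have hRest : ∑ c : PBond P k, ∑ a : Fin N, ∑ b : Fin N, Complex.normSq (Rest c a b)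
      ≤ 4 * N * (Elong + Def + ∑ c : PBond P k, ‖q c‖ ^ 2) + 16 * P.d * N * ∑ y : Site P k, ‖Λ y‖ ^ 2 := by
    have h4 : ∀ c : PBond P k, ∑ a : Fin N, ∑ b : Fin N, Complex.normSq (Rest c a b)
        ≤ 4 * (N * ‖LINE c - FACE c‖ ^ 2 + N * ‖G c - LINE c‖ ^ 2 + ∑ a : Fin N, ∑ b : Fin N, Complex.normSq (PL c a b) + N * ‖q c‖ ^ 2) := by
      intro c
      rw [hRest]
      refine (sum_normSq_four_le _ _ _ _).trans (mul_le_mul_of_nonneg_left ?_ (by norm_num))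
      have h1 := sum_normSq_le_mul_opNorm_sq (LINE c - FACE c)
      have h2 := sum_normSq_le_mul_opNorm_sq (G c - LINE c)
      have h3 := sum_normSq_le_mul_opNorm_sq (-q c)
      rw [norm_neg] at h3
      linarith [h1, h2, h3]
    have hPLsum : ∑ c : PBond P k, ∑ a : Fin N, ∑ b : Fin N, Complex.normSq (PL c a b) ≤ 4 * P.d * N * ∑ y : Site P k, ‖Λ y‖ ^ 2 := by
      rw [hPL]; exact sum_normSq_pureGauge_le V Λ
    have hN : (0 : ℝ) ≤ N := Nat.cast_nonneg N
    have hE' := mul_le_mul_of_nonneg_left hE hN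
    have hL' := mul_le_mul_of_nonneg_left hL hN
    calc ∑ c : PBond P k, ∑ a : Fin N, ∑ b : Fin N, Complex.normSq (Rest c a b)
        ≤ ∑ c : PBond P k, 4 * (N * ‖LINE c - FACE c‖ ^ 2 + N * ‖G c - LINE c‖ ^ 2 + ∑ a : Fin N, ∑ b : Fin N, Complex.normSq (PL c a b) + N * ‖q c‖ ^ 2) :=
          Finset.sum_le_sum fun c _ => h4 c
      _ = 4 * (N * ∑ c : PBond P k, ‖LINE c - FACE c‖ ^ 2 + N * ∑ c : PBond P k, ‖G c - LINE c‖ ^ 2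
            + ∑ c : PBond P k, ∑ a : Fin N, ∑ b : Fin N, Complex.normSq (PL c a b) + N * ∑ c : PBond P k, ‖q c‖ ^ 2) := by
          rw [← Finset.mul_sum, Finset.sum_add_distrib, Finset.sum_add_distrib, Finset.sum_add_distrib, Finset.mul_sum, Finset.mul_sum, Finset.mul_sum]
      _ ≤ 4 * (N * Elong + N * Def + 4 * P.d * N * ∑ y : Site P k, ‖Λ y‖ ^ 2 + N * ∑ c : PBond P k, ‖q c‖ ^ 2) := by linarith [hE', hL', hPLsum]
      _ = 4 * N * (Elong + Def + ∑ c : PBond P k, ‖q c‖ ^ 2) + 16 * P.d * N * ∑ y : Site P k, ‖Λ y‖ ^ 2 := by ring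
  have hXle : 2 * ∑ c : PBond P k, (((D c)ᴴ * FACE c).trace).re ≤ CF / θ * ℓ * K' + θ * ℓ⁻¹ * M + Ce * e * ℓ⁻¹ * M + CG * Elong + JVH := by
    have habs := le_abs_self (∑ c : PBond P k, (((D c)ᴴ * FACE c).trace).re)
    have hX' : 2 * |∑ c : PBond P k, (((D c)ᴴ * FACE c).trace).re| ≤ CF / θ * ℓ * K' + θ * ℓ⁻¹ * M + Ce * e * ℓ⁻¹ * M + CG * Elong + JVH := by
      rw [hD]; exact hX
    linarith [hX', habs]
  have hfin : ∑ c : PBond P k, ∑ a : Fin N, ∑ b : Fin N, Complex.normSq (D c a b)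
      ≤ (CF / θ * ℓ * K' + θ * ℓ⁻¹ * M + Ce * e * ℓ⁻¹ * M + CG * Elong + JVH)
        + 4 * N * (Elong + Def + ∑ c : PBond P k, ‖q c‖ ^ 2) + 16 * P.d * N * ∑ y : Site P k, ‖Λ y‖ ^ 2 := by linarith [hsum, hRest, hXle]
  simpa only [hD] using hfin

end Summit.QuantumFields.YangMills.Theorems.Prop7CovFaceFluxRow

end
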